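import Mathlib
import HarnessLib
import Summits.HubbardSuperconductivity.HubbardSuperconductivity.Theorems.KLProgrammeKLRegimeEngineTwoLegSpLegStepSplitRates

/-!
# Row C2 (`hsp`) at every scale with the SCALE-0 STEP SUPPLIED SEPARATELY (cell gate-hubbard-kl, seat hubbard-kl-k3c5-p2 g7)

The all-scales doors of `…EngineTwoLegSpLegStepSplit(Rates)` take the per-scale point estimates (R)/(D) uniformly for every `n ≤ N`, including
`n = 0`.  But the scale-`0` step is ALREADY a theorem of the scale-0 lane in its own (grid) currency — p1b's `abs_klLocalPart_flowFrame_zero_spLeg_le_inv`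
(`≤ 1/L₁` at the registered thresholds) — and no lane will produce scale-0 data in the dual currency of the `n ≥ 1` suppliers.  This file therefore splits
the induction's input: STEP(0) as ONE hypothesis `hstep0` (in STEP's binder shape at `n = 0`, where the histories, lower rates and frame comparability are
vacuous and the frames are `K₀ = 0`), and (R)/(D)/budget only for `1 ≤ n ≤ N`.

* `spLeg_allScales_of_pointDefects_hist_of_stepZero` (arbitrary comparison history);
* `spLeg_allScales_of_pointDefects_V17F2_rates_of_stepZero` (rev-2 bundle, private rates `a`, `a n ≤ Q.CL β n/4`; `hstep0` with the vacuous binders dropped).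

Proofs only; no definitions; nothing about the model is asserted.  References: BGM 2006 §2.4 (2.23) [cite: BenfattoGiulianiMastropietro2006].
-/

noncomputable section

namespace Summit.HubbardSuperconductivity.HubbardSuperconductivity.Theorems.EngineV8

set_option linter.dupNamespace false -- summit = problem name (single-conjunct summit), D-0017

open Real Finset Set Literature.MathematicalPhysics.QuantumLattice Literature.Probability.LatticeModels
open Literature.MathematicalPhysics.QuantumLattice.BandSectorCounting
open Summit.HubbardSuperconductivity.HubbardSuperconductivity.Theorems.KLProgrammeLegKernels
open Summit.HubbardSuperconductivity.HubbardSuperconductivity.Theorems.DispersionFlow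
open Summit.HubbardSuperconductivity.HubbardSuperconductivity.Theorems.PerturbedFermiCurve
open Summit.HubbardSuperconductivity.HubbardSuperconductivity.Theorems.KLRegimeSplit
open Summit.HubbardSuperconductivity.HubbardSuperconductivity.Theorems.TwoPointAssembly

section Hist

variable {L : ℕ} {hist : (L' M' : ℕ) → [NeZero L'] → [NeZero M'] → ℕ → Prop} {Q : EngConsts} {R : RenConsts} {β U μ c : ℝ}

/-- **THE SPATIAL NESTED LEG AT ALL SCALES `n ≤ N`: STEP(0) GIVEN, the point estimates only for `1 ≤ n ≤ N`** (arbitrary comparison history yielding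
`C⁴` readings).  `hstep0` is STEP(0) in the binder shape of `spLeg_allScales_of_step_hist` (its history / lower-rate / frame hypotheses are vacuous at
`n = 0`). -/
theorem spLeg_allScales_of_pointDefects_hist_of_stepZero (hR : ∀ j, 0 ≤ R.Gfr j) (hc : 0 < c) (hcle : c ≤ klCurveC3 R) (hU : 0 < U)
    (hUle : U ≤ klCurveU0 R) (hβmin : klBetaMin ≤ β) (hβc : β ≤ Real.exp (c / U ^ 2)) (hμ : μ ∈ klWindowC)
    (hC : ∀ (L' M' : ℕ) [NeZero L'] [NeZero M'] (j : ℕ), hist L' M' j →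
      ContDiff ℝ 4 (fun θ : ℝ => klLocalPart L' M' β U μ (klFlowFrameU L' M' β U μ j) j θ))
    {N : ℕ} {a b d : ℕ → ℝ}
    (hstep0 : ∀ (Mq : ℕ → ℕ) (L₁ L₂ M₂ : ℕ) [NeZero L₁] [NeZero L₂] [NeZero M₂], L ≤ L₁ → L₁ ∣ L₂ → Q.M0 β L₁ ≤ M₂ → Mq L₁ ≤ M₂ →
      Q.M0 β L₂ ≤ M₂ → Mq L₂ ≤ M₂ → (∀ j < 0, hist L₁ M₂ j) → (∀ j < 0, hist L₂ M₂ j) →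
      (∀ m < 0, ∀ θ : ℝ, |klLocalPart L₁ M₂ β U μ (klFlowFrameU L₁ M₂ β U μ m) m θ -
        klLocalPart L₂ M₂ β U μ (klFlowFrameU L₂ M₂ β U μ m) m θ| ≤ a m / L₁) →
      (∀ q : Fin 2 → ℝ, |(klFlowFrameU L₁ M₂ β U μ 0).eval q - (klFlowFrameU L₂ M₂ β U μ 0).eval q| ≤ (∑ m ∈ range 0, a m) / L₁) →
        ∀ θ : ℝ, |klLocalPart L₁ M₂ β U μ (klFlowFrameU L₁ M₂ β U μ 0) 0 θ -
          klLocalPart L₂ M₂ β U μ (klFlowFrameU L₂ M₂ β U μ 0) 0 θ| ≤ a 0 / L₁)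
    (hb : ∀ n, 1 ≤ n → n ≤ N → 0 ≤ b n)
    (hKOK : ∀ n, 1 ≤ n → n ≤ N → ∀ (L' M' : ℕ) [NeZero L'] [NeZero M'], L ≤ L' → Q.M0 β L' ≤ M' → (∀ j < n, hist L' M' j) →
      FrameOK R U (nScales β) μ (klFlowFrameU L' M' β U μ n))
    (hgrad : ∀ n, 1 ≤ n → n ≤ N → ∀ (Mq : ℕ → ℕ) (L₁ L₂ M₂ : ℕ) [NeZero L₁] [NeZero L₂] [NeZero M₂], L ≤ L₁ → L₁ ∣ L₂ → Q.M0 β L₁ ≤ M₂ →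
      Mq L₁ ≤ M₂ → Q.M0 β L₂ ≤ M₂ → Mq L₂ ≤ M₂ → (∀ j < n, hist L₁ M₂ j) → (∀ j < n, hist L₂ M₂ j) →
      (∀ m < n, ∀ θ : ℝ, |klLocalPart L₁ M₂ β U μ (klFlowFrameU L₁ M₂ β U μ m) m θ -
        klLocalPart L₂ M₂ β U μ (klFlowFrameU L₂ M₂ β U μ m) m θ| ≤ a m / L₁) →
      (∀ q : Fin 2 → ℝ, |(klFlowFrameU L₁ M₂ β U μ n).eval q - (klFlowFrameU L₂ M₂ β U μ n).eval q| ≤ (∑ m ∈ range n, a m) / L₁) →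
        ∀ q : Momentum, |frameLevel μ (klFlowFrameU L₁ M₂ β U μ n) q| ≤ (∑ m ∈ range n, a m) / L₁ →
          ‖fderiv ℝ (evalM (symInterp L₁ (klLocSelfEnergyRe L₁ M₂ β U μ (klFlowFrameU L₁ M₂ β U μ n) n))) q‖ ≤ b n)
    (hD : ∀ n, 1 ≤ n → n ≤ N → ∀ (Mq : ℕ → ℕ) (L₁ L₂ M₂ : ℕ) [NeZero L₁] [NeZero L₂] [NeZero M₂], L ≤ L₁ → L₁ ∣ L₂ → Q.M0 β L₁ ≤ M₂ →
      Mq L₁ ≤ M₂ → Q.M0 β L₂ ≤ M₂ → Mq L₂ ≤ M₂ → (∀ j < n, hist L₁ M₂ j) → (∀ j < n, hist L₂ M₂ j) →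
      (∀ m < n, ∀ θ : ℝ, |klLocalPart L₁ M₂ β U μ (klFlowFrameU L₁ M₂ β U μ m) m θ -
        klLocalPart L₂ M₂ β U μ (klFlowFrameU L₂ M₂ β U μ m) m θ| ≤ a m / L₁) →
      (∀ q : Fin 2 → ℝ, |(klFlowFrameU L₁ M₂ β U μ n).eval q - (klFlowFrameU L₂ M₂ β U μ n).eval q| ≤ (∑ m ∈ range n, a m) / L₁) →
        ∀ θ : ℝ, |(symInterp L₁ (klLocSelfEnergyRe L₁ M₂ β U μ (klFlowFrameU L₁ M₂ β U μ n) n)).eval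
              (klFermiPoint μ (klFlowFrameU L₂ M₂ β U μ n) θ) -
            (symInterp L₂ (klLocSelfEnergyRe L₂ M₂ β U μ (klFlowFrameU L₂ M₂ β U μ n) n)).eval
              (klFermiPoint μ (klFlowFrameU L₂ M₂ β U μ n) θ)| ≤ d n / L₁)
    (hbudget : ∀ n, 1 ≤ n → n ≤ N → b n * (∑ m ∈ range n, a m) / klCurveD + d n ≤ a n) :
    ∀ n ≤ N, ∀ (Mq : ℕ → ℕ) (L₁ L₂ M₂ : ℕ) [NeZero L₁] [NeZero L₂] [NeZero M₂], L ≤ L₁ → L₁ ∣ L₂ → Q.M0 β L₁ ≤ M₂ → Mq L₁ ≤ M₂ →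
      Q.M0 β L₂ ≤ M₂ → Mq L₂ ≤ M₂ → (∀ j < n, hist L₁ M₂ j) → (∀ j < n, hist L₂ M₂ j) →
        ∀ θ : ℝ, |klLocalPart L₁ M₂ β U μ (klFlowFrameU L₁ M₂ β U μ n) n θ -
          klLocalPart L₂ M₂ β U μ (klFlowFrameU L₂ M₂ β U μ n) n θ| ≤ a n / L₁ := by
  refine spLeg_allScales_of_step_hist hμ hC fun n hn => ?_
  rcases Nat.eq_zero_or_pos n with rfl | hpos
  · exact hstep0
  · exact spLeg_step_of_pointDefect_hist hR hc hcle hU hUle hβmin hβc hμ (hb n hpos hn) (hKOK n hpos hn) (hgrad n hpos hn) (hD n hpos hn)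
      (hbudget n hpos hn)

end Hist

section V17F2

variable {L : ℕ} {G : GeoConsts} {P : SplitConsts} {Q : EngConsts} {R : RenConsts} {β U μ c : ℝ}

/-- **ROW C2 (`hsp`) AT EVERY SCALE `n ≤ N ≤ nScales β + 1`, STEP(0) GIVEN, private rates**: `hstep0` — the scale-`0` leg with the vacuous binders
dropped (`∀ …thresholds…, ∀ θ, |Δν₀| ≤ a 0 / L₁`; e.g. p1b's `abs_klLocalPart_flowFrame_zero_spLeg_le_inv` gives `1/L₁` at `Q := klEngQ7 P R`, so any
`a 0 ≥ 1`), and for `1 ≤ n ≤ N` the point estimates (R) `hgrad`, (D) `hD` and the budget; `a n ≤ Q.CL β n/4` closes to the public ceiling. -/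
theorem spLeg_allScales_of_pointDefects_V17F2_rates_of_stepZero (hR : ∀ j, 0 ≤ R.Gfr j) (hc : 0 < c) (hcle : c ≤ klCurveC3 R) (hU : 0 < U)
    (hUle : U ≤ klCurveU0 R) (hβmin : klBetaMin ≤ β) (hβc : β ≤ Real.exp (c / U ^ 2)) (hμ : μ ∈ klWindowC)
    (h0 : FrameOK R U (nScales β) μ 0) {N : ℕ} (hN : N ≤ nScales β + 1) {a b d : ℕ → ℝ} (ha : ∀ n ≤ N, a n ≤ Q.CL β n / 4)
    (hstep0 : ∀ (Mq : ℕ → ℕ) (L₁ L₂ M₂ : ℕ) [NeZero L₁] [NeZero L₂] [NeZero M₂], L ≤ L₁ → L₁ ∣ L₂ → Q.M0 β L₁ ≤ M₂ → Mq L₁ ≤ M₂ →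
      Q.M0 β L₂ ≤ M₂ → Mq L₂ ≤ M₂ →
        ∀ θ : ℝ, |klLocalPart L₁ M₂ β U μ (klFlowFrameU L₁ M₂ β U μ 0) 0 θ -
          klLocalPart L₂ M₂ β U μ (klFlowFrameU L₂ M₂ β U μ 0) 0 θ| ≤ a 0 / L₁)
    (hb : ∀ n, 1 ≤ n → n ≤ N → 0 ≤ b n)
    (hgrad : ∀ n, 1 ≤ n → n ≤ N → ∀ (Mq : ℕ → ℕ) (L₁ L₂ M₂ : ℕ) [NeZero L₁] [NeZero L₂] [NeZero M₂], L ≤ L₁ → L₁ ∣ L₂ → Q.M0 β L₁ ≤ M₂ →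
      Mq L₁ ≤ M₂ → Q.M0 β L₂ ≤ M₂ → Mq L₂ ≤ M₂ →
      (∀ j < n, histV17F2 L₁ M₂ G P Q R β U μ j ∧ TwoLegSlopes L₁ M₂ R β U μ (klFlowFrameU L₁ M₂ β U μ j) j) →
      (∀ j < n, histV17F2 L₂ M₂ G P Q R β U μ j ∧ TwoLegSlopes L₂ M₂ R β U μ (klFlowFrameU L₂ M₂ β U μ j) j) →
      (∀ m < n, ∀ θ : ℝ, |klLocalPart L₁ M₂ β U μ (klFlowFrameU L₁ M₂ β U μ m) m θ -
        klLocalPart L₂ M₂ β U μ (klFlowFrameU L₂ M₂ β U μ m) m θ| ≤ a m / L₁) →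
      (∀ q : Fin 2 → ℝ, |(klFlowFrameU L₁ M₂ β U μ n).eval q - (klFlowFrameU L₂ M₂ β U μ n).eval q| ≤ (∑ m ∈ range n, a m) / L₁) →
        ∀ q : Momentum, |frameLevel μ (klFlowFrameU L₁ M₂ β U μ n) q| ≤ (∑ m ∈ range n, a m) / L₁ →
          ‖fderiv ℝ (evalM (symInterp L₁ (klLocSelfEnergyRe L₁ M₂ β U μ (klFlowFrameU L₁ M₂ β U μ n) n))) q‖ ≤ b n)
    (hD : ∀ n, 1 ≤ n → n ≤ N → ∀ (Mq : ℕ → ℕ) (L₁ L₂ M₂ : ℕ) [NeZero L₁] [NeZero L₂] [NeZero M₂], L ≤ L₁ → L₁ ∣ L₂ → Q.M0 β L₁ ≤ M₂ →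
      Mq L₁ ≤ M₂ → Q.M0 β L₂ ≤ M₂ → Mq L₂ ≤ M₂ →
      (∀ j < n, histV17F2 L₁ M₂ G P Q R β U μ j ∧ TwoLegSlopes L₁ M₂ R β U μ (klFlowFrameU L₁ M₂ β U μ j) j) →
      (∀ j < n, histV17F2 L₂ M₂ G P Q R β U μ j ∧ TwoLegSlopes L₂ M₂ R β U μ (klFlowFrameU L₂ M₂ β U μ j) j) →
      (∀ m < n, ∀ θ : ℝ, |klLocalPart L₁ M₂ β U μ (klFlowFrameU L₁ M₂ β U μ m) m θ -
        klLocalPart L₂ M₂ β U μ (klFlowFrameU L₂ M₂ β U μ m) m θ| ≤ a m / L₁) →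
      (∀ q : Fin 2 → ℝ, |(klFlowFrameU L₁ M₂ β U μ n).eval q - (klFlowFrameU L₂ M₂ β U μ n).eval q| ≤ (∑ m ∈ range n, a m) / L₁) →
        ∀ θ : ℝ, |(symInterp L₁ (klLocSelfEnergyRe L₁ M₂ β U μ (klFlowFrameU L₁ M₂ β U μ n) n)).eval
              (klFermiPoint μ (klFlowFrameU L₂ M₂ β U μ n) θ) -
            (symInterp L₂ (klLocSelfEnergyRe L₂ M₂ β U μ (klFlowFrameU L₂ M₂ β U μ n) n)).eval
              (klFermiPoint μ (klFlowFrameU L₂ M₂ β U μ n) θ)| ≤ d n / L₁)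
    (hbudget : ∀ n, 1 ≤ n → n ≤ N → b n * (∑ m ∈ range n, a m) / klCurveD + d n ≤ a n) :
    ∀ n ≤ N, ∀ (Mq : ℕ → ℕ) (L₁ L₂ M₂ : ℕ) [NeZero L₁] [NeZero L₂] [NeZero M₂], L ≤ L₁ → L₁ ∣ L₂ → Q.M0 β L₁ ≤ M₂ → Mq L₁ ≤ M₂ →
      Q.M0 β L₂ ≤ M₂ → Mq L₂ ≤ M₂ →
      (∀ j < n, histV17F2 L₁ M₂ G P Q R β U μ j ∧ TwoLegSlopes L₁ M₂ R β U μ (klFlowFrameU L₁ M₂ β U μ j) j) →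
      (∀ j < n, histV17F2 L₂ M₂ G P Q R β U μ j ∧ TwoLegSlopes L₂ M₂ R β U μ (klFlowFrameU L₂ M₂ β U μ j) j) →
        ∀ θ : ℝ, |klLocalPart L₁ M₂ β U μ (klFlowFrameU L₁ M₂ β U μ n) n θ -
          klLocalPart L₂ M₂ β U μ (klFlowFrameU L₂ M₂ β U μ n) n θ| ≤ Q.CL β n / 4 / L₁ := by
  intro n hn Mq L₁ L₂ M₂ _ _ _ hLL₁ hdvd hM₁ hMq₁ hM₂ hMq₂ hh₁ hh₂ θ
  have hL₁0 : (0 : ℝ) < L₁ := by exact_mod_cast Nat.pos_of_ne_zero (NeZero.ne L₁)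
  have h := spLeg_allScales_of_pointDefects_hist_of_stepZero (a := a)
    (hist := fun L'' M'' _ _ j => histV17F2 L'' M'' G P Q R β U μ j ∧ TwoLegSlopes L'' M'' R β U μ (klFlowFrameU L'' M'' β U μ j) j)
    hR hc hcle hU hUle hβmin hβc hμ (fun L' M' _ _ j h => histV17F2_slopes_contDiff L' M' j h)
    (fun Mq L₁ L₂ M₂ _ _ _ hLL₁ hdvd hM₁ hMq₁ hM₂ hMq₂ _ _ _ _ => hstep0 Mq L₁ L₂ M₂ hLL₁ hdvd hM₁ hMq₁ hM₂ hMq₂) hb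
    (fun n _ hn _ _ _ _ _ _ h => frameOK_klFlowFrameU_of_histV17F2 hR h0 (hn.trans hN) h) hgrad hD hbudget
    n hn Mq L₁ L₂ M₂ hLL₁ hdvd hM₁ hMq₁ hM₂ hMq₂ hh₁ hh₂ θ
  exact h.trans (div_le_div_of_nonneg_right (ha n hn) hL₁0.le)

end V17F2

end Summit.HubbardSuperconductivity.HubbardSuperconductivity.Theorems.EngineV8

end
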